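import Summits.ResolutionOfSingularities.ResolutionOfSingularities.Theorems.SubmaximalCutRoot
import HarnessLib

/-!
# Primary deep cut — CLASSES (lens-4 g47, node «PrimaryDeepCut», slice S1)

Doors of ROW 255 (g46 root `noForcedTowers_of_g48`): (S′) `DeepSurfaceLawAll` (carved from `MaxContactCut.SurfaceLawAll`
by `surfaceLawAll_iff_g46`) and (71′) `DeepContactLawAll` (carved from `MaxContactCut.NoContactHuggingTowers` by
`noContactHuggingTowers_iff_g46`).

* §1 LETTERS: the PRIMARY DEEP regular-surface-hugging letter `PrimaryDeepSurfaceHugging` (a hugged regular surface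
  germ `𝔭 ∋ pt m` with contact `ℓ = mult - e`, `e ≥ 2`, whose level-`ℓ` shadow is `𝔪`-PRIMARY and of surface order
  EXACTLY `e`), its law `PrimaryDeepSurfaceLaw n`, the exact complements `NonPrimaryDeep{Surface,Contact}Hugging`
  inside the door letters, and the located residual laws `NonPrimaryDeep{Surface,Contact}Law n` / `…All`.
* §2 the induction invariant `PrimaryFrame` of LAW F (slice S6): a regular-parameter frame of the strict transform of
  the hugged germ carrying the marked stalk at level `ℓ`, a shadow of surface order exactly `e`, and SURFACE
  COLENGTH of the shadow `< N`.

All `k`, all `p`, every dimension; no fact / port / Leaf binders; fully proved.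
-/

set_option linter.dupNamespace false

open CategoryTheory CategoryTheory.Limits AlgebraicGeometry TopologicalSpace IsLocalRing
open MvPolynomial Literature.AlgebraicGeometry.Resolution Scheme.IdealSheafData
open Summit.ResolutionOfSingularities.ResolutionOfSingularities.Theorems
open ForcedTowerClasses DivergentTowerClasses MonomialTowerClasses
open HugDimensionClasses SurfaceShadowClasses SurfaceShadowKernels AbsoluteContactClasses
open Summit.ResolutionOfSingularities.ResolutionOfSingularities.Theses

universe u

namespace Summit.ResolutionOfSingularities.ResolutionOfSingularities.Theorems.HugValuationCut

/-! ## §1 Letters -/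

/-- **PRIMARY DEEP regular-surface hugging** (NEW letter, g47): a regular two-dimensional germ `V(H) ∋ pt m` is hugged
for ever, the marked ideal lies in `H^ℓ` at the hugging point with `ℓ + e = mult`, `e ≥ 2` (the DEEP regime), and the
level-`ℓ` shadow of the marked stalk along `H` is `𝔪`-PRIMARY (contains a power of `𝔪`) and of surface order EXACTLY
`e` (not inside `𝔪^(e+1) + H`). -/
def PrimaryDeepSurfaceHugging (T : ForcedTower) : Prop :=
  ∃ (m : ℕ) (H : (T.St m).IdealSheafData) (ℓ e : ℕ), HugsGerm T m H ∧
    ringKrullDim ((T.St m).presheaf.stalk (T.pt m) ⧸ stalkIdeal H (T.pt m)) = (2 : WithBot ℕ∞) ∧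
    IsRegularLocalRing ((T.St m).presheaf.stalk (T.pt m) ⧸ stalkIdeal H (T.pt m)) ∧
    2 ≤ e ∧ ℓ + e = (T.D m).mult ∧
    stalkIdeal (T.D m).ideal (T.pt m) ≤ stalkIdeal H (T.pt m) ^ ℓ ∧
    (∃ N : ℕ, IsLocalRing.maximalIdeal _ ^ N ≤ levelShadow (stalkIdeal H (T.pt m)) (stalkIdeal (T.D m).ideal (T.pt m)) ℓ) ∧
    ¬ levelShadow (stalkIdeal H (T.pt m)) (stalkIdeal (T.D m).ideal (T.pt m)) ℓ ≤
        IsLocalRing.maximalIdeal _ ^ (e + 1) ⊔ stalkIdeal H (T.pt m)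

/-- **LAW F's statement**: no infinite forced tower of weight `n` hugs a regular surface germ primarily-deeply. -/
def PrimaryDeepSurfaceLaw (n : ℕ) : Prop := NoTower n PrimaryDeepSurfaceHugging

/-- **NON-PRIMARY DEEP regular-surface hugging** (the located residual letter of door (S′) after g47): deep regular
surface hugging, but NO hugged regular surface germ has an `𝔪`-primary level shadow of surface order exactly
`mult - ℓ ≥ 2` — the exact complement of `PrimaryDeepSurfaceHugging` inside `DeepSurfaceHugging`. -/
def NonPrimaryDeepSurfaceHugging (T : ForcedTower) : Prop :=
  DeepSurfaceHugging T ∧ ¬ PrimaryDeepSurfaceHugging T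

/-- **NON-PRIMARY DEEP contact hugging** (the located residual letter of door (71′) after g47): deep permanent contact,
but no primarily-deeply hugged regular surface germ — the exact complement of `PrimaryDeepSurfaceHugging` inside
`DeepContactHugging`. -/
def NonPrimaryDeepContactHugging (T : ForcedTower) : Prop :=
  DeepContactHugging T ∧ ¬ PrimaryDeepSurfaceHugging T

/-- **THE LOCATED RESIDUAL of door (S′) after g47 · UNDECIDED**: no infinite forced tower of weight `n` hugs a regular
surface germ deeply and non-primarily (paper proof: the closure-normalised weighted shadow SL-a…SL-f of
`SurfaceShadowClasses`, needed exactly when the level shadow has a curve component or is very near). -/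
def NonPrimaryDeepSurfaceLaw (n : ℕ) : Prop := NoTower n NonPrimaryDeepSurfaceHugging

/-- `NonPrimaryDeepSurfaceLaw n` for every weight `n ≥ 1` (the exact carve of `DeepSurfaceLawAll`, see
`deepSurfaceLawAll_iff_g47`). -/
def NonPrimaryDeepSurfaceLawAll : Prop := ∀ n : ℕ, 1 ≤ n → NonPrimaryDeepSurfaceLaw n

/-- **THE LOCATED RESIDUAL of door (71′) after g47 · UNDECIDED**: no infinite forced tower of weight `n` has deep
non-primary permanent contact. -/
def NonPrimaryDeepContactLaw (n : ℕ) : Prop := NoTower n NonPrimaryDeepContactHugging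

/-- `NonPrimaryDeepContactLaw n` for every weight `n ≥ 1` (the exact carve of `DeepContactLawAll`, see
`deepContactLawAll_iff_g47`). -/
def NonPrimaryDeepContactLawAll : Prop := ∀ n : ℕ, 1 ≤ n → NonPrimaryDeepContactLaw n

/-! ## §2 Cell calculus: the primary-deep cell sits inside regular-surface hugging and inside permanent contact -/

/-- a primarily-deeply hugging tower hugs a REGULAR SURFACE germ (the first three clauses of the letter). [new] -/
theorem regularSurfaceHugging_of_primaryDeepSurfaceHugging {T : ForcedTower} (h : PrimaryDeepSurfaceHugging T) :
    RegularSurfaceHugging T := by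
  obtain ⟨m, H, -, -, hH, hdim, hreg, -⟩ := h
  exact ⟨m, H, hH, hdim, hreg⟩

/-- a primarily-deeply hugging tower has PERMANENT CONTACT (g46 dominance `contactHugging_of_regularSurfaceHugging`;
`(g) (hB)` = the base-field data of `NoTower`, no Prop binder). [new] -/
theorem contactHugging_of_primaryDeepSurfaceHugging {k : Type} [Field k] (T : ForcedTower) (g : T.St 0 ⟶ Spec (.of k))
    (hB : IsBase (T.St 0) g) (h : PrimaryDeepSurfaceHugging T) : ContactHugging T :=
  contactHugging_of_regularSurfaceHugging T g hB (regularSurfaceHugging_of_primaryDeepSurfaceHugging h)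

/-! ## §3 The induction invariant of LAW F -/

/-- **the PRIMARY FRAME at stage `m + j`** (the induction invariant of LAW F): a part `u` of a regular system of
parameters generating the stalk of the `j`-th strict transform of the hugged germ `H`, the stalk of dimension `c + 2`,
the marked stalk inside `(u)^ℓ`, the level-`ℓ` shadow NOT inside `𝔪^(e+1) + (u)` (surface order exactly `e`), and the
SURFACE COLENGTH of the shadow (the length of `(𝒪/(u)) / shadow·(𝒪/(u))` over the regular surface `𝒪/(u)`) `< N`. -/
def PrimaryFrame (T : ForcedTower) (ℓ e m : ℕ) (H : (T.St m).IdealSheafData) (j c N : ℕ) : Prop :=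
  ∃ u : Fin c → (T.St (m + j)).presheaf.stalk (T.pt (m + j)),
    IsRsopPart u ∧ Ideal.span (Set.range u) = stalkIdeal (strictIter T m H j) (T.pt (m + j)) ∧
      ringKrullDim ((T.St (m + j)).presheaf.stalk (T.pt (m + j))) = (c + 2 : ℕ) ∧
        stalkIdeal (T.D (m + j)).ideal (T.pt (m + j)) ≤ Ideal.span (Set.range u) ^ ℓ ∧
          ¬ levelShadow (Ideal.span (Set.range u)) (stalkIdeal (T.D (m + j)).ideal (T.pt (m + j))) ℓ ≤
              maximalIdeal _ ^ (e + 1) ⊔ Ideal.span (Set.range u) ∧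
            Module.length ((T.St (m + j)).presheaf.stalk (T.pt (m + j)) ⧸ Ideal.span (Set.range u))
                (((T.St (m + j)).presheaf.stalk (T.pt (m + j)) ⧸ Ideal.span (Set.range u)) ⧸
                  (levelShadow (Ideal.span (Set.range u)) (stalkIdeal (T.D (m + j)).ideal (T.pt (m + j))) ℓ).map
                    (Ideal.Quotient.mk (Ideal.span (Set.range u)))) < (N : ℕ∞)

end Summit.ResolutionOfSingularities.ResolutionOfSingularities.Theorems.HugValuationCut
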